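import Summits.BirchSwinnertonDyer.BirchSwinnertonDyer.Theorems.BiquadraticEisensteinDescentHeegnerTwistCouplingInSupplySymbolicMonskyEvenDesignExistsPencil
import Summits.BirchSwinnertonDyer.BirchSwinnertonDyer.Theorems.BiquadraticEisensteinDescentHeegnerTwistCouplingInSupplySymbolicMonskyClosureSymb
import HarnessLib

set_option linter.dupNamespace false -- `Summit.BirchSwinnertonDyer.BirchSwinnertonDyer.Theorems.…` (summit = sub)
set_option autoImplicit false

/-!
# Crux `HeegnerTwistCouplingInSupply` (stmt-BirchSwinnertonDyer-21381) — EVEN THEOREM A THROUGH THE DOOR: the crux conclusion at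
# `(E_{2·P₀⋯P_k}, P₀)` from the even pencil's transversality data, modulo Burungale–Tian

Route `BiquadraticEisensteinDescent` (cell `pub/bsd-wall`, width seat `bsd-wall-cm-bed-w3` g23; `--supports` 21381, helper). Composition of
`exists_patternFree_even_design_pencil` (`…SymbolicMonskyEvenDesignExistsPencil`) with the general-`k` even door
`RealisesK.cruxOn_even_of_BT_of_forall` (`…SymbolicMonskyClosureSymb`, w3 g21): for every base datum whose even pencil `W_ev(δ)` has dimension
`2τ` and meets the three coordinate planes in dimension `≤ τ` (and honest generator), there is ONE cell list `aux` (`|aux| = τ + 1`) such that ANY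
realising primes `P` (base) and `q` (cells: distinct, prescribed classes mod `8` and symbols `(q_i/P_b)`, NOTHING asked of `(q_j/q_i)`) with
`√(∏q)·log(∏q) < π·P₀` give an imaginary quadratic `K′`, `|d_K′| > 4`, Heegner for `N(E_{2n₀})`, with `L(E_{2n₀}^{(d_K′)}, 1) ≠ 0` and
`P₀ ∤ h(K′)` — the CONCLUSION of `HeegnerTwistCouplingInSupply` at `(E_{2·P₀⋯P_k}, P₀)`, modulo the named print fact Burungale–Tian.

HONEST FRAMING: RUNG-LEVEL corner layer (even congruent `j = 1728` families); locating the primes (Linnik censuses) and the print input are NOT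
provided here; the pencil hypotheses are per base (conjecturally always satisfiable for some `δ`: memo THEOREM-B-w3g23 §5, exhaustive for `K ≤ 4`);
the crux as stated (C⁺), its registered stubs and BSD are NOT touched; nothing is closed. THEOREMS ONLY.
[cite: HeathBrown1994SelmerCongruentII, Appendix (Monsky), typescript p. 41 L20–L36] [cite: BurungaleTian2026, Thm. 1.1]
[cite: Oesterle1988Gauss, II §3 Proposition p. 57 (27)]
-/

namespace Summit.BirchSwinnertonDyer.BirchSwinnertonDyer.Theorems.SymbolicMonsky

section EvenDoor

open Matrix Module Literature.NumberTheory.EllipticCurves Literature.NumberTheory.EllipticCurves.HeathBrown1994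
  Literature.NumberTheory.EllipticCurves.HeathBrown1994.Families
open Literature.NumberTheory.EllipticCurves.Rank1Residual

variable {k : ℕ} (base : SymbData (k + 1))

/-- ★★ **EVEN THEOREM A through the door** (see the module docstring).
[cite: HeathBrown1994SelmerCongruentII, Appendix (Monsky), typescript p. 41 L20–L36] [cite: BurungaleTian2026, Thm. 1.1]
[cite: Oesterle1988Gauss, II §3 Proposition p. 57 (27)] -/
theorem exists_recipe_cruxOn_even_pencil (hBT : burungaleTian_analyticRank_eq_zero_of_selmerCorank_eq_zero_of_hasCM)
    (δ : Fin (k + 1) → ZMod 2) (τ : ℕ)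
    (hδ : ((δ, fun i => 1 + δ i) : (Fin (k + 1) → ZMod 2) × (Fin (k + 1) → ZMod 2)) ∉
      base.evenVirtualKernel.map (base.evenTwist δ))
    (hdim : finrank (ZMod 2) ↥(base.evenPencil δ) = 2 * τ)
    (h1 : finrank (ZMod 2) ↥(base.evenPencil δ ⊓
      LinearMap.ker (LinearMap.snd (ZMod 2) (Fin (k + 1) → ZMod 2) (Fin (k + 1) → ZMod 2))) ≤ τ)
    (h2 : finrank (ZMod 2) ↥(base.evenPencil δ ⊓
      LinearMap.ker (LinearMap.fst (ZMod 2) (Fin (k + 1) → ZMod 2) (Fin (k + 1) → ZMod 2))) ≤ τ)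
    (h3 : finrank (ZMod 2) ↥(base.evenPencil δ ⊓ LinearMap.ker (LinearMap.fst (ZMod 2) (Fin (k + 1) → ZMod 2) (Fin (k + 1) → ZMod 2) +
      LinearMap.snd (ZMod 2) (Fin (k + 1) → ZMod 2) (Fin (k + 1) → ZMod 2))) ≤ τ) :
    ∃ aux : List AuxCell, aux.length = τ + 1 ∧ heegnerK base aux = true ∧
      ∀ (P : Fin (k + 1) → ℕ) (q : Fin aux.length → ℕ), RealisesK base aux P q →
        ∀ (n : ℕ) [(congruentNumberCurve (2 * n)).IsElliptic], (∏ b, P b) = n →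
          Real.sqrt ((∏ j, q j : ℕ) : ℝ) * Real.log ((∏ j, q j : ℕ) : ℝ) < Real.pi * P 0 →
          ∃ (K : Type) (_ : Field K) (_ : NumberField K),
            IsImaginaryQuadratic K ∧ 4 < (NumberField.discr K).natAbs ∧
            SatisfiesHeegnerHypothesis ((congruentNumberCurve (2 * n)).conductorNorm ℤ) K ∧
            ((congruentNumberCurve (2 * n)).quadraticTwist (NumberField.discr K : ℚ)).entireLFunction 1 ≠ 0 ∧
            ¬ P 0 ∣ NumberField.classNumber K := by
  obtain ⟨c₁, rest, hlen, hH, hdet⟩ := exists_patternFree_even_design_pencil base δ τ hδ hdim h1 h2 h3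
  refine ⟨c₁ :: rest, by simp [hlen], hH, ?_⟩
  intro P q hR n _ hn hsize
  exact hR.cruxOn_even_of_BT_of_forall hBT hH hdet hn hsize

end EvenDoor

end Summit.BirchSwinnertonDyer.BirchSwinnertonDyer.Theorems.SymbolicMonsky
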